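import Summits.AnomalousDissipation.AnomalousDissipation.Theorems.BaireTransferRobustLoudUpgradeLine

/-!
# Stub `stub_primedTransfer` of the line `malkin-cone-group-orbits` (crux stmt-AnomalousDissipation-1144,
# `BaireTransfer.RobustLoudUpgrade`, companion c3): the PRIMED crux closes the route

Side deliverable for the planner.  The route `BaireTransfer` consumes the crux `RobustLoudUpgrade`
(`LOUD_j(S,E,ε) ⊆ closure (interior LOUD_j(S,2E,ε/2))` for all `S ⊇ S₀`) only through the glue
`DensityGlue : DenseLoudDesignerForces → RobustLoudUpgrade → BaireTarget`
(`Theorems/BaireTransferDensityGlue.lean`).  The glue needs strictly less: the `interior ∘ closure` ("PRIMED") form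

  `∃ S₀, ∀ S ⊇ S₀, ∀ E ε, 0 < ε → ∀ j, interior (closure LOUD_j(S,E,ε)) ⊆ closure (interior LOUD_j(S,2E,ε/2))`,

because `DenseLoudDesignerForces` hands over an OPEN `U ⊆ closure LOUD_j`, which therefore lies in
`interior (closure LOUD_j)` (`interior_maximal`).  This file records, sorry-free and by pure point-set topology:

* `primed_of_crux` — the crux implies its primed form (`closure_minimal`, `interior_subset`);
* `interior_closure_subset_of_nowhereDense` — the transfer lemma that makes the primed form immune to
  NOWHERE-DENSE exceptional sets of loud forces: if `L ⊆ closure T ∪ N` with `interior (closure N) = ∅` and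
  `T ⊆ closure (interior L₂)`, then `interior (closure L) ⊆ closure (interior L₂)` (the open set
  `interior (closure L) \ closure N` is dense in `interior (closure L)` and lies in the closed set
  `closure T ⊆ closure (interior L₂)`);
* `primed_of_tame` — corollary: a residual of the shape "every loud force is a limit of TAME relaxed-loud forces
  OR lies in a nowhere-dense exceptional set", with the tame classes inside `closure (interior LOUD)`, proves the
  primed crux (compare `RobustLoudUpgrade_of` in `…RobustLoudUpgradeLine.lean`, which has no exceptional set);
* `stub_primedTransfer` (registered) — primed crux `+ DenseLoudDesignerForces ⟹ BaireTarget`, verbatim the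
  8-line proof of `densityGlue_proof` with `interior_maximal` inserted.

`loud` is the vocabulary file's name for the route's set-builder loud set (`crux_iff` there is `Iff.rfl`), so the
route statements `DenseLoudDesignerForces`, `BaireTarget` are met definitionally.

References: the route file `Theses/BaireTransfer.lean` (items 1143–1145, 1147); Oxtoby, *Measure and Category*
(1980) Ch. 1, 9 (nowhere-dense sets, Baire category vocabulary); pattern from `Theorems/BaireTransferDensityGlue.lean`.
-/

-- `Summit.<Summit>.<Problem>` is the tree's mandated summit-side namespace (CONVENTIONS §2); for this
-- single-conjunct summit the two coincide, so the duplicate is deliberate.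
set_option linter.dupNamespace false

noncomputable section

open scoped BigOperators Topology
open Filter Set Function TopologicalSpace MeasureTheory

namespace Summit.AnomalousDissipation.AnomalousDissipation.Theorems.RobustLoudUpgrade.PrimedTransfer

open Literature.Analysis.FunctionSpaces Literature.Analysis.FunctionSpaces.Torus
open Literature.Analysis.FluidPDE
open Summit.AnomalousDissipation.AnomalousDissipation.Theses.BaireTransfer

/-! ## §1 Pure topology: the nowhere-dense transfer lemma -/

/-- **Nowhere-dense transfer.**  In any topological space: if `L ⊆ closure T ∪ N` where `closure N` has empty
interior (i.e. `N` is nowhere dense) and `T ⊆ closure (interior L₂)`, then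
`interior (closure L) ⊆ closure (interior L₂)`.  Proof: `O := interior (closure L) ⊆ closure T ∪ closure N`;
the open set `O ∩ (closure N)ᶜ` lies in `closure T ⊆ closure (interior L₂)` (closed) and is dense in `O`
because `(closure N)ᶜ` is dense (`interior_eq_empty_iff_dense_compl`, `Dense.open_subset_closure_inter`);
hence `O ⊆ closure (O ∩ (closure N)ᶜ) ⊆ closure (interior L₂)`. [folklore] -/
theorem interior_closure_subset_of_nowhereDense {X : Type*} [TopologicalSpace X] {L T L₂ N : Set X}
    (hL : L ⊆ closure T ∪ N) (hN : interior (closure N) = ∅) (hT : T ⊆ closure (interior L₂)) :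
    interior (closure L) ⊆ closure (interior L₂) := by
  -- `O := interior (closure L)` lies in `closure T ∪ closure N`
  have hO : interior (closure L) ⊆ closure T ∪ closure N := by
    refine interior_subset.trans ?_
    have h := closure_mono hL
    rwa [closure_union, closure_closure] at h
  -- the complement of the closed nowhere-dense set `closure N` is dense
  have hd : Dense (closure N)ᶜ := interior_eq_empty_iff_dense_compl.1 hN
  -- so the open set `O` lies in the closure of `O ∩ (closure N)ᶜ`
  have h₁ : interior (closure L) ⊆ closure (interior (closure L) ∩ (closure N)ᶜ) :=
    hd.open_subset_closure_inter isOpen_interior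
  -- and `O ∩ (closure N)ᶜ ⊆ closure T ⊆ closure (interior L₂)`
  have h₂ : interior (closure L) ∩ (closure N)ᶜ ⊆ closure (interior L₂) := by
    rintro x ⟨hx, hxN⟩
    exact closure_minimal hT isClosed_closure ((hO hx).resolve_right hxN)
  exact h₁.trans (closure_minimal h₂ isClosed_closure)

/-- The special case without exceptional set (`N = ∅`): `L ⊆ closure T` and `T ⊆ closure (interior L₂)` give
`interior (closure L) ⊆ closure (interior L₂)`. [folklore] -/
theorem interior_closure_subset_of_subset_closure {X : Type*} [TopologicalSpace X] {L T L₂ : Set X}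
    (hL : L ⊆ closure T) (hT : T ⊆ closure (interior L₂)) :
    interior (closure L) ⊆ closure (interior L₂) :=
  interior_closure_subset_of_nowhereDense (N := ∅) (hL.trans Set.subset_union_left) (by simp) hT

/-- An open set contained in `closure L` is contained in `interior (closure L)` (`interior_maximal`); this is
the only place where the route's glue touches the loud set `L` itself. [folklore] -/
theorem open_subset_interior_closure {X : Type*} [TopologicalSpace X] {U L : Set X} (hU : IsOpen U)
    (h : U ⊆ closure L) : U ⊆ interior (closure L) :=
  interior_maximal h hU

/-! ## §2 The primed crux -/

/-- **The crux implies the primed crux.**  From `LOUD_j(S,E,ε) ⊆ closure (interior LOUD_j(S,2E,ε/2))`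
(`RobustLoudUpgrade`, unfolded to the `loud` form by the definitional `crux_iff`) one gets
`closure LOUD_j(S,E,ε) ⊆ closure (interior LOUD_j(S,2E,ε/2))` (`closure_minimal`, the right-hand side is closed)
and a fortiori the inclusion for `interior (closure LOUD_j(S,E,ε))`. [folklore] -/
theorem primed_of_crux : RobustLoudUpgrade →
    ∃ S₀ : Finset (Fin 3 → ℤ), ∀ S : Finset (Fin 3 → ℤ), S₀ ⊆ S → ∀ (E ε : ℝ), 0 < ε → ∀ j : ℕ,
      interior (closure (loud S (1 / ((j : ℝ) + 1)) E ε)) ⊆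
        closure (interior (loud S (1 / ((j : ℝ) + 1)) (2 * E) (ε / 2))) := by
  intro h
  obtain ⟨S₀, hS₀⟩ := crux_iff.1 h
  refine ⟨S₀, fun S hS E ε hε j => ?_⟩
  -- `L ⊆ closure T` with `T := interior LOUD_j(S,2E,ε/2) ⊆ closure (interior LOUD_j(S,2E,ε/2))`
  exact interior_closure_subset_of_subset_closure (hS₀ S hS E ε hε j) subset_closure

/-- **Primed crux from a tame-or-nowhere-dense residual** (the shape of residual the primed form tolerates and
the plain crux does not).  Suppose that for all `S ⊇ S₀`, all ceilings `a > 0` and budgets `E`, `ε > 0`: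
every loud force lies in the closure of a "tame" class `T S a (2E) (ε/2)` at the relaxed budgets OR in an
exceptional set `N S a E ε` whose closure has empty interior, and the tame classes satisfy
`T S a E ε ⊆ closure (interior (loud S a E ε))`.  Then the primed crux holds with stock `S₀`
(by `interior_closure_subset_of_nowhereDense` at `a = 1/(j+1)`). [folklore] -/
theorem primed_of_tame {S₀ : Finset (Fin 3 → ℤ)}
    {T N : (S : Finset (Fin 3 → ℤ)) → ℝ → ℝ → ℝ → Set (Coeff S)}
    (hL : ∀ S : Finset (Fin 3 → ℤ), S₀ ⊆ S → ∀ (a E ε : ℝ), 0 < a → 0 < ε →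
      loud S a E ε ⊆ closure (T S a (2 * E) (ε / 2)) ∪ N S a E ε)
    (hN : ∀ S : Finset (Fin 3 → ℤ), S₀ ⊆ S → ∀ (a E ε : ℝ), 0 < a → 0 < ε →
      interior (closure (N S a E ε)) = ∅)
    (hT : ∀ (S : Finset (Fin 3 → ℤ)) (a E ε : ℝ), T S a E ε ⊆ closure (interior (loud S a E ε))) :
    ∃ S₀ : Finset (Fin 3 → ℤ), ∀ S : Finset (Fin 3 → ℤ), S₀ ⊆ S → ∀ (E ε : ℝ), 0 < ε → ∀ j : ℕ,
      interior (closure (loud S (1 / ((j : ℝ) + 1)) E ε)) ⊆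
        closure (interior (loud S (1 / ((j : ℝ) + 1)) (2 * E) (ε / 2))) := by
  refine ⟨S₀, fun S hS E ε hε j => ?_⟩
  have ha : (0 : ℝ) < 1 / ((j : ℝ) + 1) := by positivity
  exact interior_closure_subset_of_nowhereDense (hL S hS _ E ε ha hε) (hN S hS _ E ε ha hε)
    (hT S _ (2 * E) (ε / 2))

/-! ## §3 The primed crux closes the route -/

/-- **Primed glue.**  `primed crux → DenseLoudDesignerForces → BaireTarget`: with `S₀` from the primed crux and
`(S ⊇ S₀, E, ε, U)` from `DenseLoudDesignerForces S₀`, the target holds with witnesses `(S, 2E, ε/2, U)`: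
`U ⊆ closure LOUD_j(S,E,ε)` and `U` open give `U ⊆ interior (closure LOUD_j(S,E,ε))` (`interior_maximal`),
which the primed crux maps into `closure (interior LOUD_j(S,2E,ε/2))`; `0 < ε/2` by `positivity`.
(Pattern: `densityGlue_proof`.) [folklore] -/
theorem baireTarget_of_primed
    (hP : ∃ S₀ : Finset (Fin 3 → ℤ), ∀ S : Finset (Fin 3 → ℤ), S₀ ⊆ S → ∀ (E ε : ℝ), 0 < ε → ∀ j : ℕ,
      interior (closure (loud S (1 / ((j : ℝ) + 1)) E ε)) ⊆
        closure (interior (loud S (1 / ((j : ℝ) + 1)) (2 * E) (ε / 2))))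
    (hD : DenseLoudDesignerForces) : BaireTarget := by
  obtain ⟨S₀, hS₀⟩ := hP
  obtain ⟨S, hSS, E, ε, hε, U, hUo, hUne, hUd⟩ := hD S₀
  refine ⟨S, 2 * E, ε / 2, by positivity, U, hUo, hUne, fun j => ?_⟩
  -- `U ⊆ closure LOUD_j(S,E,ε)` (route set-builder form, definitionally `loud S (1/(j+1)) E ε`)
  have hU : U ⊆ closure (loud S (1 / ((j : ℝ) + 1)) E ε) := hUd j
  exact (open_subset_interior_closure hUo hU).trans (hS₀ S hSS E ε hε j)

-- Sanity check (kernel-checked, not a declaration: the item `DensityGlue` is closed by `densityGlue_proof`):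
-- the route's glue factors through `primed_of_crux` and `baireTarget_of_primed`.
example : DensityGlue :=
  fun hD hR => baireTarget_of_primed (primed_of_crux hR) hD

/-- **Registered stub `stub_primedTransfer`** (side deliverable of the line `malkin-cone-group-orbits`, companion
c3): the PRIMED crux `∃ S₀ ∀ S ⊇ S₀ ∀ E ε, 0 < ε → ∀ j, interior (closure LOUD_j(S,E,ε)) ⊆
closure (interior LOUD_j(S,2E,ε/2))` together with `DenseLoudDesignerForces` already gives the route's
`BaireTarget` (by `baireTarget_of_primed`: the open `U ⊆ closure LOUD_j` lies in `interior (closure LOUD_j)`).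
[folklore] -/
theorem stub_primedTransfer : (∃ S₀ : Finset (Fin 3 → ℤ), ∀ S : Finset (Fin 3 → ℤ), S₀ ⊆ S → ∀ (E ε : ℝ), 0 < ε → ∀ j : ℕ, interior (closure (loud S (1 / ((j : ℝ) + 1)) E ε)) ⊆ closure (interior (loud S (1 / ((j : ℝ) + 1)) (2 * E) (ε / 2)))) → DenseLoudDesignerForces → BaireTarget :=
  fun hP hD => baireTarget_of_primed hP hD

end Summit.AnomalousDissipation.AnomalousDissipation.Theorems.RobustLoudUpgrade.PrimedTransfer

end
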